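import Summits.CriticalPhenomena.PercolationContinuityZ3.Theorems.Transplant.SkelPhiStepINegOrient
import Summits.CriticalPhenomena.PercolationContinuityZ3.Theorems.Transplant.SkelFrmQuasiBParamsLF
import Summits.CriticalPhenomena.PercolationContinuityZ3.Theorems.Transplant.SkelFrmBParamsLF
import Summits.CriticalPhenomena.PercolationContinuityZ3.Theorems.Transplant.SkelNegBParamsLF
import Summits.CriticalPhenomena.PercolationContinuityZ3.Theorems.Transplant.SkelFrmFrom1ParamsLO
import Summits.CriticalPhenomena.PercolationContinuityZ3.Theorems.Transplant.SkelFrm1ParamsLO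
import Summits.CriticalPhenomena.PercolationContinuityZ3.Theorems.Transplant.SkelNeg1ParamsLO
import Summits.CriticalPhenomena.PercolationContinuityZ3.Theorems.Transplant.SkelPhiCellsWeakGLevels
import Summits.CriticalPhenomena.PercolationContinuityZ3.Theorems.Transplant.SkelNegBParamsLO
import Summits.CriticalPhenomena.PercolationContinuityZ3.Theorems.Transplant.PlanarSkeletonFrmQuasiDefs
import Summits.CriticalPhenomena.PercolationContinuityZ3.Theorems.Transplant.PlanarSkeletonFrmDefs
import Summits.CriticalPhenomena.PercolationContinuityZ3.Theorems.Transplant.SkelPhiStepIDataNS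
import Summits.CriticalPhenomena.PercolationContinuityZ3.Theorems.Transplant.SkelFrmQuasi1ParamsLBL
import Summits.CriticalPhenomena.PercolationContinuityZ3.Theorems.Transplant.SkelFrmQuasi1ParamsPO
import HarnessLib
import Summits.CriticalPhenomena.PercolationContinuityZ3.Theorems.Transplant.SkelFrmBParamsLO
/-!
# GEN-Q PORT (WAVE-Q table v0.8 section 2, row G026, U-level L5; captain R-6/R-7 2026-08-27: carrier token swap `PlanarSkeletonFrmFrom ↦ PlanarSkeletonFrmQuasi`)
# of the tree module «Transplant/SkelFrmFromBParamsLO» (sha256 78b5305ee052e0bc…) onto the quasi-step carrier `PlanarSkeletonFrmQuasi` (p507026): «SkelFrmQuasiBParamsLO»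

ORIGINAL TITLE: N2 (frames-only node `SamePDropOfSkeletonFrm₁`, OPEN) params column over `PlanarSkeletonFrm` — (ζ″) ledger, shape (B′) of record ((R-14)):

builds on p205010 (kernel theorem, internal audit signed; external expert review pending) — nothing in this file uses p205010; NOTHING is claimed about any open node
((N3-b), the end state).  Lane `prim-bschramm`, seat `prim-bschramm-p3` (gen 30; design owner; tool = captain gen-1 g4's port_genq.py R-14 --cone + p3-g30 slot-value patch T1).  Helper file (`--supports stmt-CriticalPhenomena-4575 --as helper`).
PORT RULES (U-wave r1–r4 re-used, GEN-Q hunk classes of p3-g29 #6136): declaration order, names and proof texts are those of «SkelFrmFromBParamsLO», byte-identical except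
(i) the carrier token `PlanarSkeletonFrmFrom ↦ PlanarSkeletonFrmQuasi` in binders, `namespace`/`end` lines and qualified names (module names `SkelFrmFrom… ↦ SkelFrmQuasi…`
in imports of already-ported rows); (ii) `Φ.step ↦ Φ.qstep` with the called Steps lemma replaced by its `…Q`/`_q` twin and the cost `Φ.M` threaded — IN THIS FILE exactly one:
the producer `steps_φL : Skelφ.Steps G (φL …)` ↦ `qStepsN_φL : Skelφ.QStepsN G (φL …) Φ.M := Φ.qstep.oriφ _` (no consumer of it in this file); (iii) `Φ.cyl_connected ↦ Φ.cyl_reach` readers (none unless listed); (iv) graph-ball radii / window floors ×`Φ.M` (none unless listed).  Carrier-free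
residents stay imported/exported from the original «SkelFrmBParamsLO» exactly as in the FrmFrom port.  Docstrings and citations are the original's.

-/

noncomputable section

open scoped Classical

namespace Summit.CriticalPhenomena.PercolationContinuityZ3.Theorems.Transplant

namespace PlanarSkeletonFrmQuasi

namespace NegB

open Literature.Probability.Percolation Literature.Probability.LatticeModels SimpleGraph KNCells
open SkelConc (Consts)
open BoxProdZ2 (ConcRadiiG)
open Skelφ (oriφ trφ)
open Skelφ.StepI (DataN)
open Neg

section LOLevel

/-! ## §1 The orientation bits and the oriented maps at the two pairs -/

/-- **The long pair's orientation bit** `oL := ori t M_L (n_L f)` (values at the merged record). [this work] -/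
def oL (κ : Consts) {V : Type} [DecidableEq V] [Countable V] {G : SimpleGraph V} [G.LocallyFinite] (Φ : PlanarSkeletonFrmQuasi G) (t : V) (p : unitInterval) (D : Skelφ.StepI.DataNS V) (DT : DataN V) (ori : V → ℕ → ℕ → Bool) (g : ℕ) (f : ℕ) : Bool := ori t (ML κ Φ t p (D.orient DT ori) g) (nL κ Φ t p (D.orient DT ori) g f)

/-- **The planar map the CELLS read** (long pair): `Φ.φ` or its transpose. [this work] -/
def φL (κ : Consts) {V : Type} [DecidableEq V] [Countable V] {G : SimpleGraph V} [G.LocallyFinite] (Φ : PlanarSkeletonFrmQuasi G) (t : V) (p : unitInterval) (D : Skelφ.StepI.DataNS V) (DT : DataN V) (ori : V → ℕ → ℕ → Bool) (g : ℕ) (f : ℕ) : V → Site 2 := oriφ Φ.φ (oL κ Φ t p D DT ori g f)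

-- GEN-Q (R-2, captain 2026-08-27): `PlanarSkeletonFrmFrom.NegB.fineO` is not in the used cone of the node top — not ported.

/-- `φL` is 1-Lipschitz. [folklore] -/
theorem lip_φL (κ : Consts) {V : Type} [DecidableEq V] [Countable V] {G : SimpleGraph V} [G.LocallyFinite] (Φ : PlanarSkeletonFrmQuasi G) (t : V) (p : unitInterval) (D : Skelφ.StepI.DataNS V) (DT : DataN V) (ori : V → ℕ → ℕ → Bool) (g : ℕ) (f : ℕ) : Skelφ.Lip G (φL κ Φ t p D DT ori g f) := Skelφ.lip_oriφ Φ.lip _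

/-- `φL` has exact-footprint quasi-steps of cost `Φ.M` (GEN-Q hunk (ii): the FrmFrom twin's `steps_φL : Skelφ.Steps G (φL …)` := `Skelφ.steps_oriφ Φ.step _`
becomes the `QStepsN` producer at cost `Φ.M`, «SkelPhiQStepsNMaps» `Skelφ.QStepsN.oriφ`; consumers call the binder wave's `…Q`/`_q` twins with it). [folklore] -/
theorem qStepsN_φL (κ : Consts) {V : Type} [DecidableEq V] [Countable V] {G : SimpleGraph V} [G.LocallyFinite] (Φ : PlanarSkeletonFrmQuasi G) (t : V) (p : unitInterval) (D : Skelφ.StepI.DataNS V) (DT : DataN V) (ori : V → ℕ → ℕ → Bool) (g : ℕ) (f : ℕ) : Skelφ.QStepsN G (φL κ Φ t p D DT ori g f) Φ.M := Φ.qstep.oriφ _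

-- GEN-Q (R-2, captain 2026-08-27): `PlanarSkeletonFrmFrom.NegB.fineO_eq` is not in the used cone of the node top — not ported.

/-! ## §2 The clauses of the two pairs from `FactsO` -/

/-- The two pairs are admissible for the merged record: `M₀ ≤ M_u`, `n₁ M_u ≤ n_s`, `M₀ ≤ M_L`, `n₁ M_L ≤ n_L f`. [folklore] -/
theorem pairs_adm (κ : Consts) {V : Type} [DecidableEq V] [Countable V] {G : SimpleGraph V} [G.LocallyFinite] (Φ : PlanarSkeletonFrmQuasi G) (t : V) (p : unitInterval) (D : Skelφ.StepI.DataNS V) (DT : DataN V) (ori : V → ℕ → ℕ → Bool) (g : ℕ) (f : ℕ) : (D.orient DT ori).M₀ ≤ Mu (D.orient DT ori) ∧ (D.orient DT ori).n₁ (Mu (D.orient DT ori)) ≤ nS (D.orient DT ori) ∧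
    (D.orient DT ori).M₀ ≤ ML κ Φ t p (D.orient DT ori) g ∧ (D.orient DT ori).n₁ (ML κ Φ t p (D.orient DT ori) g) ≤ nL κ Φ t p (D.orient DT ori) g f :=
  ⟨M₀_le_Mu _, n₁_le_nS _, (M₀_le_Mu _).trans (Mu_le_ML κ Φ t p _ g), (n₁L_le_nL κ Φ t p _ g f).1⟩

/-- **THE LONG CLAUSE FROM `FactsO`**: the merged record's geometric clause at the long pair FOR THE ORIENTED MAP `φL`, and the shear bound `|h_L| ≤ 10·n_L`.
[this work] -/
theorem clauseL_of_factsO (κ : Consts) {V : Type} [DecidableEq V] [Countable V] {G : SimpleGraph V} [G.LocallyFinite] (Φ : PlanarSkeletonFrmQuasi G) (t : V) (p : unitInterval) (D : Skelφ.StepI.DataNS V) (DT : DataN V) (ori : V → ℕ → ℕ → Bool) (g : ℕ) (f : ℕ) (hR : DT.R = D.R)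
    (hfacts : ∀ M, D.M₀ ≤ M → ∀ n, D.n₁ M ≤ n →
      (ori t M n = true → D.EqGeom G Φ.φ t M n ∧ (D.hgt t M n).natAbs ≤ 10 * n) ∧
      (ori t M n = false → DT.EqGeom G (trφ Φ.φ) t M n ∧ (DT.hgt t M n).natAbs ≤ 10 * n)) :
    (D.orient DT ori).EqGeom G (φL κ Φ t p D DT ori g f) t (ML κ Φ t p (D.orient DT ori) g) (nL κ Φ t p (D.orient DT ori) g f) ∧
      (hL κ Φ t p (D.orient DT ori) g f).natAbs ≤ 10 * nL κ Φ t p (D.orient DT ori) g f := by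
  obtain ⟨-, -, hM, hn⟩ := pairs_adm κ Φ t p D DT ori g f
  exact Skelφ.StepI.orient_clause_all hR hfacts _ hM _ hn

/-- **THE NUMERIC LONG CLAUSE FROM `FactsO`** (what every LF fact consumes). [this work] -/
theorem eqNumL_of_factsO (κ : Consts) {V : Type} [DecidableEq V] [Countable V] {G : SimpleGraph V} [G.LocallyFinite] (Φ : PlanarSkeletonFrmQuasi G) (t : V) (p : unitInterval) (D : Skelφ.StepI.DataNS V) (DT : DataN V) (ori : V → ℕ → ℕ → Bool) (g : ℕ) (f : ℕ) (hR : DT.R = D.R)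
    (hfacts : ∀ M, D.M₀ ≤ M → ∀ n, D.n₁ M ≤ n →
      (ori t M n = true → D.EqGeom G Φ.φ t M n ∧ (D.hgt t M n).natAbs ≤ 10 * n) ∧
      (ori t M n = false → DT.EqGeom G (trφ Φ.φ) t M n ∧ (DT.hgt t M n).natAbs ≤ 10 * n)) :
    EqNumL κ Φ t p (D.orient DT ori) g f :=
  eqNumL_of_eqGeom κ Φ t p _ g f _ (clauseL_of_factsO κ Φ t p D DT ori g f hR hfacts).1

/-! ## §3 The scheme-geometry package of the fine cells -/

-- GEN-Q (R-2, captain 2026-08-27): `PlanarSkeletonFrmFrom.NegB.geom_fine_at` is not in the used cone of the node top — not ported.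

-- GEN-Q (R-2, captain 2026-08-27): `PlanarSkeletonFrmFrom.NegB.geom_fineO_of_factsO` is not in the used cone of the node top — not ported.

end LOLevel

end NegB

end PlanarSkeletonFrmQuasi

end Summit.CriticalPhenomena.PercolationContinuityZ3.Theorems.Transplant

end
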